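import Mathlib
import Literature.Combinatorics.Optimization.LpRelaxationsVersusSheraliAdams
import Literature.GroupTheory.PermutationGroups.SmallIndexSubgroups
import HarnessLib

/-!
# Symmetric LP relaxations of Max-CSPs are no stronger than Sherali–Adams
# (Chan–Lee–Raghavendra–Steurer 2013/2016, §4: Theorem 4.1, Lemma 4.2) — PROVED

Source: [ChanEtAl2016] arXiv:1309.0563v3 §4 (held `paper:arxiv-1309.0563`, p. 12–13): "Theorem 4.1.
Fix a `k`-ary CSP over the boolean domain.  Suppose that, for some numbers `m, d > 0`, the `d`-round
Sherali–Adams relaxation for `Π_m` cannot achieve a `(c,s)`-approximation.  Then no symmetric LP of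
size `≤ \binom{n}{d}` can achieve a `(c,s)`-approximation on `Π_n` where `n = 2m`."  "Lemma 4.2.
Suppose a family of functions `Q = {q_i : {−1,1}ⁿ → ℝ : i = 1,…,R}` is closed under the action of
`S_n`.  If `R < \binom{n}{d}` for `d < n/4`, then each function `q_i` depends only on a subset
`J_i ⊆ [n]` of at most `d` coordinates and possibly the value of the sum `Σ_j x_j`."  Lemma 4.3 =
[Yannakakis91] = Dixon–Mortimer Thm 5.2B is the tree's
`Literature.GroupTheory.PermutationGroups.alternating_fixing_le_of_index_lt_choose`.

Vocabulary: `LPRelaxation k n 𝒫 R` (`LPRelaxationsMaxCSP.lean`).  RENDERING of "symmetric LP"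
(§2 p. 6: "for every `σ ∈ S_n` there exists `σ̃ ∈ S_D` such that `\widetilde{σx} = σ̃ x̃` and the
feasible region `P` remains invariant under the permutation `σ̃` of coordinates"; size = "number of
facets", p. 5): `LPRelaxation.IsSymmetric` asks for the coordinate permutation `σ̃` AND a permutation
`π` of the `R` defining inequalities with `A_{π i} = σ̃ · A_i`, `b_{π i} = b_i` — i.e. the inequality
SYSTEM is permuted, as in Yannakakis' symmetric extended formulations; for the facet description of a
`σ̃`-invariant polytope (the printed size measure) this is automatic, and it is exactly what the proof
of Thm 2.3 uses (p. 7: "the faces of `P` are mapped to each other by the permutation `σ̃` … the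
constraint `⟨A_i, σ̃ y⟩ ≤ b_i` is the same as `⟨A_j, y⟩ ≤ b_j` for some `j`").  Other recorded
deviations: `|J_i| < d` (Dixon–Mortimer) in place of `≤ d`; the size bound is `R < \binom{n}{d}` (what
Lemma 4.2 and the proof give; the theorem prints `≤`); the guard `m > 4` (`n = 2m > 8`, the tree's
Dixon–Mortimer hypothesis) and `2d ≤ m` (`4d ≤ n`; printed `d < n/4`).

Contents (all PROVED; 0 named facts): `LPRelaxation.slack`, `LPRelaxation.IsSymmetric`,
`IsSymmetric.exists_perm_slack` (the symmetric half of Thm 2.3: the slack family is closed under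
`S_n`), `ChanEtAl2016_lemma42` (Lemma 4.2: invariance under all permutations fixing a set `X_i`,
`|X_i| < d`, hence dependence on `x|_{X_i}` and the Hamming weight only), `ChanEtAl2016_thm41`
(Theorem 4.1, with the anti-diagonal planting `x ↦ (x, ¬x)` of p. 13).
-/

noncomputable section

open Finset Equiv Matrix

namespace Literature.Combinatorics.Optimization

/-! ### Slack functions and symmetric LP relaxations -/

namespace LPRelaxation

variable {k n R : ℕ} {P : Set ((Fin k → Bool) → Bool)}

/-- The slack `q_i(x) = b_i − ⟨A_i, x̃⟩ ≥ 0` of the `i`-th inequality at the point `x̃ = v_x`.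
[cite: ChanEtAl2016, Thm 2.3 proof (arXiv v3 p. 7: "q_i(x) = b_i − ⟨A_i, x̃⟩")] -/
def slack (L : LPRelaxation k n P R) (i : Fin R) (x : Fin n → Bool) : ℝ :=
  L.b i - (L.A *ᵥ L.v x) i

/-- Slacks are nonnegative. [cite: ChanEtAl2016, Thm 2.3 proof (arXiv v3 p. 7)] -/
theorem slack_nonneg (L : LPRelaxation k n P R) (i : Fin R) (x : Fin n → Bool) : 0 ≤ L.slack i x :=
  sub_nonneg.2 (L.mem x i)

/-- **A symmetric LP relaxation**: every permutation `σ` of the `n` variables is realised by a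
permutation `σ̃ = τ` of the `D` coordinates (`ṽ(σ x) = τ ṽ(x)`, with `(σ x)_j = x_{σ⁻¹ j}` and
`(τ y)_j = y_{τ⁻¹ j}`) that permutes the defining inequality system (`A_{π i} = τ A_i`, `b_{π i} = b_i`).
See the module docstring for the relation to the printed "`σ̃ P = P`".
[cite: ChanEtAl2016, §2 "Symmetric Linear Programs" (arXiv v3 p. 6)] -/
def IsSymmetric (L : LPRelaxation k n P R) : Prop :=
  ∀ σ : Perm (Fin n), ∃ (τ : Perm (Fin L.D)) (π : Perm (Fin R)),
    (∀ (x : Fin n → Bool) (j : Fin L.D), L.v (x ∘ ⇑σ.symm) j = L.v x (τ.symm j)) ∧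
    (∀ (i : Fin R) (j : Fin L.D), L.A (π i) j = L.A i (τ.symm j)) ∧
    (∀ i : Fin R, L.b (π i) = L.b i)

/-- **Thm 2.3, symmetric half: the slack family of a symmetric LP relaxation is closed under `S_n`**:
`q_{π i}(σ x) = q_i(x)`. [cite: ChanEtAl2016, Thm 2.3 (arXiv v3 p. 7: "one can choose the family Q = {q_1,…,q_R} of functions to be invariant under the action of S_n")] -/
theorem IsSymmetric.exists_perm_slack {L : LPRelaxation k n P R} (hL : L.IsSymmetric)
    (σ : Perm (Fin n)) :
    ∃ π : Perm (Fin R), ∀ (i : Fin R) (x : Fin n → Bool), L.slack (π i) (x ∘ ⇑σ.symm) = L.slack i x := by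
  obtain ⟨τ, π, hv, hA, hb⟩ := hL σ
  refine ⟨π, fun i x => ?_⟩
  unfold slack
  rw [hb i]
  congr 1
  simp only [Matrix.mulVec, dotProduct]
  simp_rw [hA i, hv x]
  exact Equiv.sum_comp τ.symm (fun j => L.A i j * L.v x j)

end LPRelaxation

/-! ### Lemma 4.2: invariant families of fewer than `C(n,d)` functions -/

section Lemma42

variable {n R : ℕ}

/-- The stabiliser of `q` under `(σ · q)(x) = q(σ⁻¹ x)`, as a subgroup of `Perm (Fin n)`:
`{ρ | ∀ x, q(x ∘ ρ⁻¹) = q(x)}`. [cite: ChanEtAl2016, Lemma 4.2 proof (arXiv v3 p. 12: "Stab(f)")] -/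
def cubeStabilizer (q : (Fin n → Bool) → ℝ) : Subgroup (Perm (Fin n)) where
  carrier := {ρ | ∀ x : Fin n → Bool, q (x ∘ ⇑ρ.symm) = q x}
  one_mem' := by intro x; rfl
  mul_mem' := by
    intro ρ ρ' hρ hρ' x
    have h : x ∘ ⇑(ρ * ρ').symm = (x ∘ ⇑ρ'.symm) ∘ ⇑ρ.symm := by
      funext j; simp [Perm.mul_def]
    rw [h, hρ, hρ']
  inv_mem' := by
    intro ρ hρ x
    have h := hρ (x ∘ ⇑ρ)
    have h2 : (x ∘ ⇑ρ) ∘ ⇑ρ.symm = x := by funext j; simp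
    rw [h2] at h
    have h3 : x ∘ ⇑ρ⁻¹.symm = x ∘ ⇑ρ := by funext j; simp [Perm.inv_def]
    rw [h3, ← h]

/-- Membership in the stabiliser. [cite: ChanEtAl2016, Lemma 4.2 proof (arXiv v3 p. 12)] -/
theorem mem_cubeStabilizer {q : (Fin n → Bool) → ℝ} {ρ : Perm (Fin n)} :
    ρ ∈ cubeStabilizer q ↔ ∀ x : Fin n → Bool, q (x ∘ ⇑ρ.symm) = q x := Iff.rfl

/-- **Orbit counting**: if the family `(q_i)_{i<R}` is closed under `S_n`, each stabiliser has index
`≤ R` ("`|Orb(q_i)| < \binom{n}{d}`, hence `|Stab(q_i)| ≥ d!(n−d)!`").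
[cite: ChanEtAl2016, Lemma 4.2 proof (arXiv v3 p. 12)] -/
theorem index_cubeStabilizer_le {q : Fin R → (Fin n → Bool) → ℝ}
    (hclosed : ∀ σ : Perm (Fin n), ∃ π : Perm (Fin R), ∀ (i : Fin R) (x : Fin n → Bool),
      q (π i) (x ∘ ⇑σ.symm) = q i x)
    (i : Fin R) : (cubeStabilizer (q i)).index ≤ R := by
  classical
  choose π hπ using hclosed
  set H := cubeStabilizer (q i) with hH
  -- `σ ↦ π_σ(i)` separates the left cosets of the stabiliser
  have hsep : ∀ σ σ' : Perm (Fin n), π σ i = π σ' i → σ⁻¹ * σ' ∈ H := by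
    intro σ σ' hj x
    have hA := hπ σ i ((x ∘ ⇑σ'.symm) ∘ ⇑σ)
    have hB := hπ σ' i x
    have e1 : ((x ∘ ⇑σ'.symm) ∘ ⇑σ) ∘ ⇑σ.symm = x ∘ ⇑σ'.symm := by funext j; simp
    rw [e1, hj, hB] at hA
    have e2 : x ∘ ⇑(σ⁻¹ * σ').symm = (x ∘ ⇑σ'.symm) ∘ ⇑σ := by
      funext j; simp [Perm.mul_def, Perm.inv_def]
    rw [e2]; exact hA.symm
  set F : (Perm (Fin n) ⧸ H) → Fin R := fun c => π c.out i with hF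
  have hFinj : Function.Injective F := by
    intro c c' h
    have hmem := hsep c.out c'.out h
    rw [← QuotientGroup.eq] at hmem
    rwa [QuotientGroup.out_eq', QuotientGroup.out_eq'] at hmem
  have h := Nat.card_le_card_of_injective F hFinj
  rw [Subgroup.index_eq_card]
  simpa using h

/-- Permuting the coordinates does not change the number of `true` coordinates. [folklore] -/
private theorem card_filter_comp_perm (x : Fin n → Bool) (ρ : Perm (Fin n)) :
    (univ.filter fun j => (x ∘ ⇑ρ) j = true).card = (univ.filter fun j => x j = true).card := by
  classical
  have h : (univ.filter fun j => (x ∘ ⇑ρ) j = true) = (univ.filter fun j => x j = true).map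
      ρ.symm.toEmbedding := by
    ext j
    simp only [mem_filter, mem_univ, true_and, Function.comp_apply, mem_map_equiv, Equiv.symm_symm]
  rw [h, card_map]

/-- Swapping two coordinates carrying the same value does nothing. [folklore] -/
private theorem comp_swap_of_eq (x : Fin n → Bool) {a b : Fin n} (hab : x a = x b) :
    x ∘ ⇑(Equiv.swap a b) = x := by
  funext j
  simp only [Function.comp_apply]
  rcases eq_or_ne j a with rfl | hja
  · rw [swap_apply_left, hab]
  rcases eq_or_ne j b with rfl | hjb
  · rw [swap_apply_right, hab]
  rw [swap_apply_of_ne_of_ne hja hjb]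

/-- **From even to all permutations fixing `X`** (the transposition trick of p. 12: "For every
`x ∈ {−1,1}ⁿ` there will be two coordinates `a, b ∉ J_i` such that `x_a = x_b` … `q_i(σ π_{ab} x) =
q_i(π_{ab} x) = q_i(x)`"): if every even permutation fixing `X` pointwise stabilises `q` and
`|Xᶜ| ≥ 3`, then every permutation fixing `X` pointwise stabilises `q`.
[cite: ChanEtAl2016, Lemma 4.2 proof (arXiv v3 p. 12)] -/
theorem comp_perm_eq_of_fix {q : (Fin n → Bool) → ℝ} {X : Finset (Fin n)}
    (heven : ∀ ρ : Perm (Fin n), (∀ j ∈ X, ρ j = j) → Perm.sign ρ = 1 → ρ ∈ cubeStabilizer q)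
    (hX : 3 ≤ (Xᶜ).card) (ρ : Perm (Fin n)) (hρ : ∀ j ∈ X, ρ j = j) (x : Fin n → Bool) :
    q (x ∘ ⇑ρ.symm) = q x := by
  classical
  rcases Int.units_eq_one_or (Perm.sign ρ) with hs | hs
  · exact heven ρ hρ hs x
  · -- two coordinates outside `X` with equal values
    have hlt : (univ : Finset Bool).card < (Xᶜ).card := by simp; omega
    obtain ⟨a, ha, b, hb, hab, hxab⟩ :=
      exists_ne_map_eq_of_card_lt_of_maps_to hlt (f := x) (fun j _ => mem_univ (x j))
    rw [mem_compl] at ha hb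
    set ρ' : Perm (Fin n) := ρ * Equiv.swap a b with hρ'
    have hρ'fix : ∀ j ∈ X, ρ' j = j := by
      intro j hj
      have hja : j ≠ a := fun h => ha (h ▸ hj)
      have hjb : j ≠ b := fun h => hb (h ▸ hj)
      rw [hρ', Perm.mul_apply, swap_apply_of_ne_of_ne hja hjb, hρ j hj]
    have hρ'sign : Perm.sign ρ' = 1 := by
      rw [hρ', Perm.sign_mul, Perm.sign_swap hab, hs]; norm_num
    have h := heven ρ' hρ'fix hρ'sign x
    have e : x ∘ ⇑ρ'.symm = (x ∘ ⇑(Equiv.swap a b)) ∘ ⇑ρ.symm := by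
      funext j; simp [hρ', Perm.mul_def, Equiv.symm_swap]
    rw [e, comp_swap_of_eq x hxab] at h
    exact h

/-- **Dependence on `x|_X` and the Hamming weight only**: if every permutation fixing `X` pointwise
stabilises `q`, then `q(x) = q(y)` whenever `x, y` agree on `X` and have the same number of `true`
coordinates (reach `y` from `x` by transpositions outside `X`).
[cite: ChanEtAl2016, Lemma 4.2 proof (arXiv v3 p. 12–13: "q_i … depends only on the assignment to coordinates in J_i and the hamming weight of the assignment to coordinates in J̄_i")] -/
theorem eq_of_agree_of_card_eq {q : (Fin n → Bool) → ℝ} {X : Finset (Fin n)}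
    (hall : ∀ ρ : Perm (Fin n), (∀ j ∈ X, ρ j = j) → ∀ x : Fin n → Bool, q (x ∘ ⇑ρ.symm) = q x)
    {x y : Fin n → Bool} (hag : ∀ j ∈ X, x j = y j)
    (hcard : (univ.filter fun j => x j = true).card = (univ.filter fun j => y j = true).card) :
    q x = q y := by
  classical
  -- induction on the number of disagreements
  suffices main : ∀ (D : ℕ) (x : Fin n → Bool), (univ.filter fun j => x j ≠ y j).card ≤ D →
      (∀ j ∈ X, x j = y j) →
      (univ.filter fun j => x j = true).card = (univ.filter fun j => y j = true).card → q x = q y from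
    main _ x le_rfl hag hcard
  intro D
  induction D with
  | zero =>
    intro x hD _ _
    have hxy : x = y := by
      funext j
      by_contra h
      have : j ∈ (univ.filter fun j => x j ≠ y j) := mem_filter.2 ⟨mem_univ _, h⟩
      rw [card_eq_zero.1 (Nat.le_zero.1 hD)] at this
      simp at this
    rw [hxy]
  | succ D ih =>
    intro x hD hag hcard
    by_cases hxy : x = y
    · rw [hxy]
    -- a coordinate with `x = true, y = false` and one with `x = false, y = true`
    have hA : ¬ (univ.filter fun j => x j = true) ⊆ (univ.filter fun j => y j = true) := by
      intro hsub
      have heq := eq_of_subset_of_card_le hsub hcard.ge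
      apply hxy; funext j
      have := congrArg (j ∈ ·) heq
      simp only [mem_filter, mem_univ, true_and, eq_iff_iff] at this
      cases hx : x j <;> cases hy : y j <;> simp_all
    have hB : ¬ (univ.filter fun j => y j = true) ⊆ (univ.filter fun j => x j = true) := by
      intro hsub
      have heq := eq_of_subset_of_card_le hsub hcard.le
      apply hxy; funext j
      have := congrArg (j ∈ ·) heq
      simp only [mem_filter, mem_univ, true_and, eq_iff_iff] at this
      cases hx : x j <;> cases hy : y j <;> simp_all
    obtain ⟨a, ha, hay⟩ := not_subset.1 hA
    obtain ⟨b, hb, hbx⟩ := not_subset.1 hB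
    simp only [mem_filter, mem_univ, true_and] at ha hay hb hbx
    have hya : y a = false := by simpa using hay
    have hxb : x b = false := by simpa using hbx
    have hab : a ≠ b := fun h => by rw [h] at ha; rw [ha] at hxb; exact Bool.noConfusion hxb
    have haX : a ∉ X := fun h => by have := hag a h; rw [ha, hya] at this; exact Bool.noConfusion this
    have hbX : b ∉ X := fun h => by have := hag b h; rw [hxb, hb] at this; exact Bool.noConfusion this
    -- swap `a` and `b` in `x`
    set x' : Fin n → Bool := x ∘ ⇑(Equiv.swap a b) with hx'
    have hfix : ∀ j ∈ X, (Equiv.swap a b) j = j := fun j hj =>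
      swap_apply_of_ne_of_ne (fun h => haX (h ▸ hj)) (fun h => hbX (h ▸ hj))
    have hqx' : q x' = q x := by
      have h := hall (Equiv.swap a b) hfix x
      rwa [Equiv.symm_swap] at h
    have hx'a : x' a = y a := by simp [hx', swap_apply_left, hxb, hya]
    have hx'b : x' b = y b := by simp [hx', swap_apply_right, ha, hb]
    have hx'j : ∀ j, j ≠ a → j ≠ b → x' j = x j := fun j hja hjb => by
      simp [hx', swap_apply_of_ne_of_ne hja hjb]
    rw [← hqx']
    refine ih x' ?_ (fun j hj => ?_) ?_
    · -- the disagreement set lost `a` (and `b`)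
      have hsub : (univ.filter fun j => x' j ≠ y j) ⊆ (univ.filter fun j => x j ≠ y j).erase a := by
        intro j hj
        simp only [mem_filter, mem_univ, true_and] at hj
        rw [mem_erase, mem_filter]
        have hja : j ≠ a := fun h => by rw [h, hx'a] at hj; exact hj rfl
        have hjb : j ≠ b := fun h => by rw [h, hx'b] at hj; exact hj rfl
        exact ⟨hja, mem_univ _, by rwa [hx'j j hja hjb] at hj⟩
      have hmem : a ∈ (univ.filter fun j => x j ≠ y j) := by
        rw [mem_filter]; exact ⟨mem_univ _, by rw [ha, hya]; exact Bool.noConfusion⟩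
      have h := card_le_card hsub
      rw [card_erase_of_mem hmem] at h
      omega
    · rw [hx'j j (fun h => haX (h ▸ hj)) (fun h => hbX (h ▸ hj))]; exact hag j hj
    · rw [hx', card_filter_comp_perm, hcard]

/-- **Chan–Lee–Raghavendra–Steurer, Lemma 4.2 (via Yannakakis' Lemma 4.3 = Dixon–Mortimer 5.2B).**
Let `(q_i)_{i<R}` be a family of real functions on `{0,1}ⁿ` closed under the action of `S_n`
(`∀ σ ∃ π ∀ i, q_{π i}(σ x) = q_i(x)`), with `R < \binom{n}{d}`, `n > 8`, `1 ≤ d`, `4d ≤ n`.  Then for every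
`i` there is a set `X_i` of fewer than `d` coordinates such that `q_i` is invariant under every
permutation of the coordinates fixing `X_i` pointwise; consequently `q_i(x)` depends only on `x|_{X_i}`
and the Hamming weight of `x` (`eq_of_agree_of_card_eq`).
[cite: ChanEtAl2016, Lemma 4.2 and Lemma 4.3 (arXiv v3 p. 12)] -/
theorem ChanEtAl2016_lemma42 {d : ℕ} {q : Fin R → (Fin n → Bool) → ℝ}
    (hclosed : ∀ σ : Perm (Fin n), ∃ π : Perm (Fin R), ∀ (i : Fin R) (x : Fin n → Bool),
      q (π i) (x ∘ ⇑σ.symm) = q i x)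
    (hn : 8 < n) (hd : 1 ≤ d) (h4d : 4 * d ≤ n) (hR : R < n.choose d) (i : Fin R) :
    ∃ X : Finset (Fin n), X.card < d ∧
      ∀ ρ : Perm (Fin n), (∀ j ∈ X, ρ j = j) → ∀ x : Fin n → Bool, q i (x ∘ ⇑ρ.symm) = q i x := by
  classical
  have hidx : (cubeStabilizer (q i)).index < (Fintype.card (Fin n)).choose d := by
    rw [Fintype.card_fin]; exact (index_cubeStabilizer_le hclosed i).trans_lt hR
  obtain ⟨X, hXd, hX⟩ := Literature.GroupTheory.PermutationGroups.alternating_fixing_le_of_index_lt_choose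
    (cubeStabilizer (q i)) d (by rwa [Fintype.card_fin]) hd (by rwa [Fintype.card_fin]) hidx
  refine ⟨X, hXd, fun ρ hρ x => comp_perm_eq_of_fix hX ?_ ρ hρ x⟩
  rw [card_compl, Fintype.card_fin]
  omega

end Lemma42

/-! ### Theorem 4.1 -/

section Thm41

variable {m : ℕ}

/-- Folding the two halves of `[2m]` onto `[m]`: `j ↦ j` on the first half, `j ↦ j − m` on the
second. [folklore] -/
def foldHalf (m : ℕ) (j : Fin (m + m)) : Fin m :=
  if h : (j : ℕ) < m then ⟨j, h⟩ else ⟨j - m, by omega⟩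

/-- The anti-diagonal planting `x ↦ (x, ¬x) ∈ {0,1}^{2m}` ("setting `x_R = −x_L`", p. 13).
[cite: ChanEtAl2016, Thm 4.1 proof (arXiv v3 p. 13: "h_i(x) = q_i(x, −x)")] -/
def antiDiag (x : Fin m → Bool) (j : Fin (m + m)) : Bool :=
  if (j : ℕ) < m then x (foldHalf m j) else !x (foldHalf m j)

/-- The value of `(x, ¬x)` at `j` is determined by `x` at the folded coordinate. [folklore] -/
private theorem antiDiag_congr {x x' : Fin m → Bool} (j : Fin (m + m))
    (h : x (foldHalf m j) = x' (foldHalf m j)) : antiDiag x j = antiDiag x' j := by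
  unfold antiDiag
  rw [h]

/-- `(x, ¬x)` on the first half is `x`. [folklore] -/
private theorem antiDiag_castAdd (x : Fin m → Bool) (i : Fin m) :
    antiDiag x (Fin.castAdd m i) = x i := by
  have h : ((Fin.castAdd m i : Fin (m + m)) : ℕ) < m := by simp
  have hf : foldHalf m (Fin.castAdd m i) = i := by
    unfold foldHalf; rw [dif_pos h]; ext; simp
  unfold antiDiag
  rw [if_pos h, hf]

/-- `(x, ¬x)` on the second half is `¬x`. [folklore] -/
private theorem antiDiag_natAdd (x : Fin m → Bool) (i : Fin m) :
    antiDiag x (Fin.natAdd m i) = !x i := by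
  have h : ¬ ((Fin.natAdd m i : Fin (m + m)) : ℕ) < m := by simp
  have hf : foldHalf m (Fin.natAdd m i) = i := by
    unfold foldHalf; rw [dif_neg h]; ext; simp
  unfold antiDiag
  rw [if_neg h, hf]

/-- `(x, ¬x)` restricted to the first half is `x`. [folklore] -/
private theorem antiDiag_comp_castAdd (x : Fin m → Bool) :
    antiDiag x ∘ Fin.castAdd m = x := by
  funext i; exact antiDiag_castAdd x i

/-- `(x, ¬x)` always has exactly `m` coordinates equal to `true` ("the sum of all the coordinates of
`(x, −x)` is always equal to `0`"). [cite: ChanEtAl2016, Thm 4.1 proof (arXiv v3 p. 13)] -/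
theorem card_filter_antiDiag (x : Fin m → Bool) :
    (univ.filter fun j => antiDiag x j = true).card = m := by
  rw [card_filter, Fin.sum_univ_add]
  simp only [antiDiag_castAdd, antiDiag_natAdd]
  rw [← sum_add_distrib]
  have : ∀ i : Fin m, ((if x i = true then 1 else 0) + if (!x i) = true then 1 else 0) = (1 : ℕ) := by
    intro i; cases x i <;> simp
  rw [sum_congr rfl fun i _ => this i]
  simp

/-- **Chan–Lee–Raghavendra–Steurer, Theorem 4.1 — PROVED.**  Let `𝒫` be a finite family of `k`-ary
Boolean predicates, `m > 4`, `1 ≤ d`, `2d ≤ m`.  If the `d`-round Sherali–Adams relaxation of Max-`𝒫`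
cannot achieve a `(c,s)`-approximation on `m`-variable instances, then no SYMMETRIC LP relaxation of
size `R < \binom{2m}{d}` achieves a `(c,s)`-approximation on `2m`-variable instances.  Proof as printed
(p. 12–13): Thm 2.3 (`ValueLE.exists_multipliers`: `c − ℑ'(z) = λ₀ + Σ λ_i q_i(z)` with the slacks
`q_i`, a family closed under `S_{2m}` by symmetry), Lemma 4.2 (`q_i` depends on `< d` coordinates and
the weight), the planting `ℑ' = ℑ` on the first `m` variables and the anti-diagonal points `(x, ¬x)` of
constant weight, on which `h_i(x) = q_i(x, ¬x)` is a nonnegative `d`-junta, so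
`c − ℑ = λ₀ + Σ λ_i h_i` forces `Ẽ[ℑ] ≤ c` for every degree-`d` pseudoexpectation.
[cite: ChanEtAl2016, Thm 4.1 (arXiv v3 p. 12; proof p. 12–13)] -/
theorem ChanEtAl2016_thm41 {k d R : ℕ} {P : Set ((Fin k → Bool) → Bool)} {c s : ℝ}
    (hm : 4 < m) (hd : 1 ≤ d) (h2d : 2 * d ≤ m)
    (hSA : ¬ SAAchieves (n := m) P d c s) (hR : R < (m + m).choose d)
    (L : LPRelaxation k (m + m) P R) (hL : L.IsSymmetric) : ¬ L.Achieves c s := by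
  classical
  intro hAch
  -- the Sherali–Adams gap instance
  simp only [SAAchieves, not_forall, not_le] at hSA
  obtain ⟨I, hI, pE, hgap⟩ := hSA
  -- plant on the first half and take multipliers (Thm 2.3)
  let e : Fin m ↪ Fin (m + m) := ⟨Fin.castAdd m, Fin.castAdd_injective m m⟩
  obtain ⟨lam, hlam0, hlamA, hlamb⟩ := (hAch (I.plant e) (hI.plant e)).exists_multipliers
  have hrow : ∀ z : Fin (m + m) → Bool,
      c - I.val (z ∘ Fin.castAdd m) = (c - lam ⬝ᵥ L.b) + ∑ i, lam i * L.slack i z := by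
    intro z
    have hval : I.val (z ∘ Fin.castAdd m) = lam ⬝ᵥ (L.A *ᵥ L.v z) := by
      have h := L.exact (I.plant e) z
      rw [CSPInstance.plant_val] at h
      rw [show (z ∘ ⇑e) = z ∘ Fin.castAdd m from rfl] at h
      rw [h, ← hlamA, Matrix.dotProduct_mulVec]
    simp only [hval, LPRelaxation.slack, dotProduct, mul_sub, sum_sub_distrib]
    ring
  -- Lemma 4.2 for the slack family
  have hclosed : ∀ σ : Perm (Fin (m + m)), ∃ π : Perm (Fin R), ∀ (i : Fin R) (x : Fin (m + m) → Bool),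
      L.slack (π i) (x ∘ ⇑σ.symm) = L.slack i x := hL.exists_perm_slack
  have hJ := fun i => ChanEtAl2016_lemma42 hclosed (by omega) hd (by omega) hR i
  choose X hXd hXinv using hJ
  -- `h_i(x) = q_i(x, ¬x)` is a nonnegative `d`-junta
  have hjunta : ∀ i, IsJunta d (fun x : Fin m → Bool => L.slack i (antiDiag x)) := by
    intro i
    refine ⟨(X i).image (foldHalf m), (card_image_le.trans (hXd i).le), fun x x' hxx' => ?_⟩
    refine eq_of_agree_of_card_eq (hXinv i) (fun j hj => antiDiag_congr j ?_) ?_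
    · exact hxx' _ (mem_image_of_mem _ hj)
    · rw [card_filter_antiDiag, card_filter_antiDiag]
  -- `c − ℑ(x) = λ₀ + Σ λ_i h_i(x)` on `{0,1}^m`
  have hrowm : ∀ x : Fin m → Bool,
      c - I.val x = (c - lam ⬝ᵥ L.b) + ∑ i, lam i * L.slack i (antiDiag x) := by
    intro x
    have h := hrow (antiDiag x)
    rwa [antiDiag_comp_castAdd] at h
  -- apply the pseudoexpectation
  have hfun : (fun x => c - I.val x) =
      (fun _ => c - lam ⬝ᵥ L.b) + ∑ i, lam i • fun x => L.slack i (antiDiag x) := by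
    funext x
    rw [hrowm x, Pi.add_apply, Finset.sum_apply]
    simp only [Pi.smul_apply, smul_eq_mul]
  have hcf : (fun x => c - I.val x) = (fun _ => c) - I.val := by funext x; simp
  have hE : c - pE.E I.val = (c - lam ⬝ᵥ L.b) + ∑ i, lam i * pE.E (fun x => L.slack i (antiDiag x)) := by
    have h := congrArg pE.E hfun
    rw [hcf, map_sub, SAPseudoexpectation.map_const, map_add, SAPseudoexpectation.map_const, map_sum] at h
    rw [h]
    congr 1
    exact sum_congr rfl fun i _ => by rw [map_smul, smul_eq_mul]
  have hpos : 0 ≤ ∑ i, lam i * pE.E (fun x => L.slack i (antiDiag x)) :=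
    sum_nonneg fun i _ => mul_nonneg (hlam0 i)
      (pE.nonneg _ (hjunta i) fun x => L.slack_nonneg i (antiDiag x))
  have hl0 : 0 ≤ c - lam ⬝ᵥ L.b := sub_nonneg.2 hlamb
  linarith

end Thm41

end Literature.Combinatorics.Optimization

end
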